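import Mathlib
import HarnessLib
import Summits.ResolutionOfSingularities.ResolutionOfSingularities.Theorems.WildQuotientsWildQuotientResolutionConductorOneDefs

/-!
# S2: the conductor-𝟙 automorphism `σ` of `Aₙ = k[u][Dₙ⁻¹]` — existence, uniqueness, order `p`, the invariants `Tᵢ`
(crux stmt-ResolutionOfSingularities-15640 `WildQuotients.WildQuotientResolution`, line `Sketch`;
chain w45c post-V5 programme S2, design `L/res-L1-w45c-lead-1/S2-DESIGN.md` §0/§6 F1; the
construction `corePhi`/`coreSigmaHom`/`coreSigma` and `σ^p = 1` are PORTED from res-L1-w45c-idea-2's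
typed card L (Sketch L1, L10a/b, L11, L11c, `conductorOneCoreAction_holds`), the uniqueness / order /
invariant statements are new. [OURS · L1 W4.5c] — NOT a statement of the manuscript.)

For `σ : Aₙ ≃ₐ[k] Aₙ` the DEFINING LAW is `σ(uᵢ)·(1 + uᵢ) = uᵢ` for all `i` (`σ uᵢ = uᵢ/(1+uᵢ)`, i.e.
`zᵢ ↦ zᵢ + 1` for `zᵢ = 1/uᵢ`). Content:

* units: `isUnit_one_add_coreU` (`1 + uᵢ`), `isUnit_coreFactor` (`1 − uᵢ^{p−1}`), `core_natCast_p`,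
  `core_norm_invariant` (`((1+u)^{p−1} − u^{p−1})(1+u) = 1 − u^{p−1}`, the norm identity L1);
* construction: `coreSigma k p n : CoreRing k p n ≃ₐ[k] CoreRing k p n` with `coreSigma_U` (the law),
  `coreSigma_pow_p` (`σ^p = 1`);
* uniqueness: `algHom_eq_coreSigmaHom_of_law` — ANY `k`-algebra endomorphism satisfying the law is
  `σ`; the consequences for an arbitrary `σ'` of the interface `ConductorOneCore` (`σ'^p = 1`, `σ' ≠ 1`,
  `Nat.card (zpowers σ') = p`, invariance of `coreT`) are `…ConductorOneLaw.lean`;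
* the invariant-to-be `coreT k p n i = uᵢ^p·(1 − uᵢ^{p−1})⁻¹` (`= N(uᵢ) = 1/yᵢ`, `yᵢ = zᵢ^p − zᵢ`)
  with `coreT_mul`.
-/

-- single-problem summit: the doubled namespace component `ResolutionOfSingularities` is forced
set_option linter.dupNamespace false

noncomputable section

open MvPolynomial

namespace Summit.ResolutionOfSingularities.ResolutionOfSingularities.Theorems.WildQuotientResolution.ConductorOne

section Units

variable (k : Type) [Field k] (p n : ℕ)

/-- The norm identity L1 in any commutative ring of characteristic `p`:
`((1+u)^{p−1} − u^{p−1})·(1+u) = 1 − u^{p−1}` (both sides equal `(1+u)^p − u^{p−1}(1+u)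
= 1 + u^p − u^{p−1} − u^p`). [OURS · L1 W4.5c] [folklore] -/
theorem norm_identity {A : Type*} [CommRing A] [Fact p.Prime] [CharP A p] (u : A) :
    ((1 + u) ^ (p - 1) - u ^ (p - 1)) * (1 + u) = 1 - u ^ (p - 1) := by
  have hp : p - 1 + 1 = p := Nat.sub_add_cancel (Fact.out : p.Prime).one_le
  have h1 : (1 + u) ^ (p - 1) * (1 + u) = 1 + u ^ p := by
    rw [← pow_succ, hp, add_pow_char, one_pow]
  have h2 : u ^ (p - 1) * (1 + u) = u ^ (p - 1) + u ^ p := by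
    rw [mul_add, mul_one, ← pow_succ, hp]
  linear_combination h1 - h2

/-- `(1 + u) ∣ 1 − u^{p−1}` in characteristic `p`. [OURS · L1 W4.5c] [folklore] -/
theorem one_add_dvd_coreFactor {A : Type*} [CommRing A] [Fact p.Prime] [CharP A p] (u : A) :
    (1 + u) ∣ 1 - u ^ (p - 1) :=
  ⟨(1 + u) ^ (p - 1) - u ^ (p - 1), by rw [mul_comm]; exact (norm_identity p u).symm⟩

/-- `Dₙ` is a unit of `Aₙ`. [OURS · L1 W4.5c] -/
theorem isUnit_algebraMap_coreDenominator :
    IsUnit (algebraMap (MvPolynomial (Fin n) k) (CoreRing k p n) (coreDenominator k p n)) :=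
  IsLocalization.Away.algebraMap_isUnit (coreDenominator k p n)

/-- `1 − uᵢ^{p−1}` is a unit of `Aₙ` (a factor of `Dₙ`). [OURS · L1 W4.5c] -/
theorem isUnit_coreFactor (i : Fin n) : IsUnit (1 - coreU k p n i ^ (p - 1)) := by
  have hD : IsUnit (algebraMap (MvPolynomial (Fin n) k) (CoreRing k p n)
      (∏ i : Fin n, ((1 : MvPolynomial (Fin n) k) - X i ^ (p - 1)))) :=
    IsLocalization.Away.algebraMap_isUnit (coreDenominator k p n)
  rw [map_prod, IsUnit.prod_iff] at hD
  have := hD i (Finset.mem_univ i)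
  simpa only [map_sub, map_one, map_pow] using this

/-- `1 + uᵢ` is a unit of `Aₙ` (it divides the inverted `Dₙ`). [OURS · L1 W4.5c] -/
theorem isUnit_one_add_coreU [Fact p.Prime] [CharP k p] (i : Fin n) :
    IsUnit (1 + coreU k p n i) := by
  obtain ⟨c, hc⟩ := one_add_dvd_coreFactor p (X i : MvPolynomial (Fin n) k)
  have h := isUnit_coreFactor k p n i
  have e : (1 : CoreRing k p n) - coreU k p n i ^ (p - 1) =
      (1 + coreU k p n i) * algebraMap (MvPolynomial (Fin n) k) (CoreRing k p n) c := by
    have := congrArg (algebraMap (MvPolynomial (Fin n) k) (CoreRing k p n)) hc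
    simpa only [map_sub, map_one, map_pow, map_mul, map_add] using this
  rw [e] at h
  exact isUnit_of_mul_isUnit_left h

/-- `(p : Aₙ) = 0`. [OURS · L1 W4.5c] -/
theorem core_natCast_p [CharP k p] : (p : CoreRing k p n) = 0 := by
  rw [← map_natCast (algebraMap (MvPolynomial (Fin n) k) (CoreRing k p n)), CharP.cast_eq_zero,
    map_zero]

/-- L1 in `Aₙ`: `((1+uᵢ)^{p−1} − uᵢ^{p−1})·(1+uᵢ) = 1 − uᵢ^{p−1}`. [OURS · L1 W4.5c] -/
theorem core_norm_invariant [Fact p.Prime] [CharP k p] (i : Fin n) :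
    ((1 + coreU k p n i) ^ (p - 1) - coreU k p n i ^ (p - 1)) * (1 + coreU k p n i) =
      1 - coreU k p n i ^ (p - 1) := by
  have h := congrArg (algebraMap (MvPolynomial (Fin n) k) (CoreRing k p n))
    (norm_identity p (X i : MvPolynomial (Fin n) k))
  simpa only [map_mul, map_sub, map_add, map_one, map_pow] using h

/-- `Dₙ ≠ 0` in `k[u]` (evaluate at `u = 0`). [OURS · L1 W4.5c] -/
theorem coreDenominator_ne_zero [Fact p.Prime] : coreDenominator k p n ≠ 0 := by
  intro h
  have hp : p - 1 ≠ 0 := by have := (Fact.out : p.Prime).two_le; omega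
  have h1 := congrArg (MvPolynomial.eval (fun _ : Fin n => (0 : k))) h
  have h2 : MvPolynomial.eval (fun _ : Fin n => (0 : k)) (coreDenominator k p n) = 1 := by
    change MvPolynomial.eval (fun _ : Fin n => (0 : k))
      (∏ i : Fin n, ((1 : MvPolynomial (Fin n) k) - X i ^ (p - 1))) = 1
    rw [map_prod]
    refine Finset.prod_eq_one fun i _ => ?_
    rw [map_sub, map_one, map_pow, eval_X, zero_pow hp, sub_zero]
  rw [h2, map_zero] at h1
  exact one_ne_zero h1

/-- `powers Dₙ ≤` non-zero-divisors. [OURS · L1 W4.5c] -/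
theorem powers_coreDenominator_le [Fact p.Prime] :
    Submonoid.powers (coreDenominator k p n) ≤ nonZeroDivisors (MvPolynomial (Fin n) k) :=
  powers_le_nonZeroDivisors_of_noZeroDivisors (coreDenominator_ne_zero k p n)

/-- `Aₙ` is a domain (a localisation of the polynomial ring at a non-zero element).
[OURS · L1 W4.5c] -/
theorem coreRing_isDomain [Fact p.Prime] : IsDomain (CoreRing k p n) :=
  IsLocalization.isDomain_localization (powers_coreDenominator_le k p n)

/-- The structure map `k[u] → Aₙ` is injective. [OURS · L1 W4.5c] -/
theorem algebraMap_coreRing_injective [Fact p.Prime] :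
    Function.Injective (algebraMap (MvPolynomial (Fin n) k) (CoreRing k p n)) :=
  IsLocalization.injective (CoreRing k p n) (powers_coreDenominator_le k p n)

/-- `uᵢ ≠ 0` in `Aₙ`. [OURS · L1 W4.5c] -/
theorem coreU_ne_zero [Fact p.Prime] (i : Fin n) : coreU k p n i ≠ 0 := by
  intro h
  have : (X i : MvPolynomial (Fin n) k) = 0 :=
    algebraMap_coreRing_injective k p n (h.trans (map_zero _).symm)
  exact X_ne_zero i this

/-- The invariant `Tᵢ := uᵢ^p · (1 − uᵢ^{p−1})⁻¹` (`= N(uᵢ) = ∏ⱼ σʲ(uᵢ) = 1/yᵢ` with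
`yᵢ = zᵢ^p − zᵢ`). [OURS · L1 W4.5c] -/
def coreT (i : Fin n) : CoreRing k p n :=
  coreU k p n i ^ p * ↑((isUnit_coreFactor k p n i).unit⁻¹)

/-- `Tᵢ · (1 − uᵢ^{p−1}) = uᵢ^p`. [OURS · L1 W4.5c] -/
theorem coreT_mul (i : Fin n) :
    coreT k p n i * (1 - coreU k p n i ^ (p - 1)) = coreU k p n i ^ p := by
  rw [coreT, mul_assoc, (isUnit_coreFactor k p n i).val_inv_mul, mul_one]

end Units

/-! ## The construction of `σ` (idea-2 Sketch L11c, ported) -/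

section Construction

variable (k : Type) [Field k] (p n : ℕ) [Fact p.Prime] [CharP k p]

/-- The substitution `uᵢ ↦ uᵢ·(1+uᵢ)⁻¹` on the polynomial ring, valued in `Aₙ`. [OURS · L1 W4.5c] -/
def corePhi : MvPolynomial (Fin n) k →ₐ[k] CoreRing k p n :=
  MvPolynomial.aeval fun i => coreU k p n i * ↑((isUnit_one_add_coreU k p n i).unit⁻¹)

/-- Value of `corePhi` on a coordinate. [OURS · L1 W4.5c] -/
theorem corePhi_X (i : Fin n) :
    corePhi k p n (X i) = coreU k p n i * ↑((isUnit_one_add_coreU k p n i).unit⁻¹) := by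
  simp [corePhi]

/-- `(1+uᵢ)⁻¹·(1+uᵢ) = 1`. [OURS · L1 W4.5c] -/
theorem coreInv_mul (i : Fin n) :
    (↑((isUnit_one_add_coreU k p n i).unit⁻¹) : CoreRing k p n) * (1 + coreU k p n i) = 1 :=
  (isUnit_one_add_coreU k p n i).val_inv_mul

/-- `φ(1 − uᵢ^{p−1})` is a unit (times `(1+uᵢ)^{p−1}` it is `(1+uᵢ)^{p−1} − uᵢ^{p−1}`, which times
`1 + uᵢ` is the unit `1 − uᵢ^{p−1}`). [OURS · L1 W4.5c] -/
theorem isUnit_corePhi_factor (i : Fin n) : IsUnit (corePhi k p n (1 - X i ^ (p - 1))) := by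
  set u := coreU k p n i with hu
  set v : CoreRing k p n := ↑((isUnit_one_add_coreU k p n i).unit⁻¹) with hv
  have hvu : v * (1 + u) = 1 := coreInv_mul k p n i
  have hphi : corePhi k p n (1 - X i ^ (p - 1)) = 1 - (u * v) ^ (p - 1) := by
    rw [map_sub, map_one, map_pow, corePhi_X]
  have hw : IsUnit ((1 + u) ^ (p - 1) - u ^ (p - 1)) := by
    have h := isUnit_coreFactor k p n i
    rw [← hu, ← core_norm_invariant k p n i, ← hu] at h
    exact isUnit_of_mul_isUnit_left h
  have key : (1 - (u * v) ^ (p - 1)) * (1 + u) ^ (p - 1) = (1 + u) ^ (p - 1) - u ^ (p - 1) := by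
    have : (u * v) ^ (p - 1) * (1 + u) ^ (p - 1) = u ^ (p - 1) := by
      rw [← mul_pow, mul_assoc, hvu, mul_one]
    rw [sub_mul, one_mul, this]
  rw [hphi]
  rw [← key] at hw
  exact isUnit_of_mul_isUnit_left hw

/-- `φ(Dₙ)` is a unit. [OURS · L1 W4.5c] -/
theorem isUnit_corePhi_denominator :
    IsUnit ((corePhi k p n).toRingHom (coreDenominator k p n)) := by
  change IsUnit (corePhi k p n (∏ i : Fin n, ((1 : MvPolynomial (Fin n) k) - X i ^ (p - 1))))
  rw [map_prod, IsUnit.prod_iff]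
  intro i _
  exact isUnit_corePhi_factor k p n i

/-- The conductor-𝟙 endomorphism `σ` of `Aₙ` as a `k`-algebra hom (the localisation lift of `φ`).
[OURS · L1 W4.5c] -/
def coreSigmaHom : CoreRing k p n →ₐ[k] CoreRing k p n :=
  { IsLocalization.Away.lift (coreDenominator k p n) (isUnit_corePhi_denominator k p n) with
    commutes' := fun r => by
      have h1 : algebraMap k (CoreRing k p n) r = algebraMap (MvPolynomial (Fin n) k)
          (CoreRing k p n) (algebraMap k (MvPolynomial (Fin n) k) r) :=
        IsScalarTower.algebraMap_apply k (MvPolynomial (Fin n) k) (CoreRing k p n) r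
      simp only [RingHom.toMonoidHom_eq_coe, OneHom.toFun_eq_coe, MonoidHom.toOneHom_coe,
        MonoidHom.coe_coe]
      rw [h1, IsLocalization.Away.lift_eq]
      exact (corePhi k p n).commutes r }

/-- `σ` extends `φ`. [OURS · L1 W4.5c] -/
theorem coreSigmaHom_algebraMap (a : MvPolynomial (Fin n) k) :
    coreSigmaHom k p n (algebraMap (MvPolynomial (Fin n) k) (CoreRing k p n) a) = corePhi k p n a :=
  IsLocalization.Away.lift_eq (coreDenominator k p n) (isUnit_corePhi_denominator k p n) a

/-- The defining law `σ(uᵢ)·(1 + uᵢ) = uᵢ`. [OURS · L1 W4.5c] -/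
theorem coreSigmaHom_U (i : Fin n) :
    coreSigmaHom k p n (coreU k p n i) * (1 + coreU k p n i) = coreU k p n i := by
  rw [coreU, coreSigmaHom_algebraMap, corePhi_X, mul_assoc, coreInv_mul, mul_one]

/-- **Uniqueness**: a `k`-algebra endomorphism of `Aₙ` satisfying the law IS `σ` (a map out of a
localisation of `k[u]` is determined by the images of the `uᵢ`). [OURS · L1 W4.5c] -/
theorem algHom_eq_coreSigmaHom_of_law (τ : CoreRing k p n →ₐ[k] CoreRing k p n)
    (hτ : ∀ i, τ (coreU k p n i) * (1 + coreU k p n i) = coreU k p n i) :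
    τ = coreSigmaHom k p n := by
  have hX : ∀ i, τ (coreU k p n i) = coreSigmaHom k p n (coreU k p n i) := by
    intro i
    have h1 := hτ i
    have h2 := coreSigmaHom_U k p n i
    have hu := isUnit_one_add_coreU k p n i
    exact hu.mul_left_injective (h1.trans h2.symm)
  have hcomp : (τ : CoreRing k p n →+* CoreRing k p n).comp
      (algebraMap (MvPolynomial (Fin n) k) (CoreRing k p n)) =
      (coreSigmaHom k p n : CoreRing k p n →+* CoreRing k p n).comp
      (algebraMap (MvPolynomial (Fin n) k) (CoreRing k p n)) := by
    apply MvPolynomial.ringHom_ext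
    · intro r
      simp only [RingHom.comp_apply]
      have e : algebraMap (MvPolynomial (Fin n) k) (CoreRing k p n) (C r) =
          algebraMap k (CoreRing k p n) r := by
        rw [← MvPolynomial.algebraMap_eq]
        exact (IsScalarTower.algebraMap_apply k (MvPolynomial (Fin n) k) (CoreRing k p n) r).symm
      rw [e, AlgHom.coe_toRingHom, AlgHom.coe_toRingHom, AlgHom.commutes, AlgHom.commutes]
    · intro i
      simp only [RingHom.comp_apply, AlgHom.coe_toRingHom]
      exact hX i
  have h := IsLocalization.ringHom_ext (Submonoid.powers (coreDenominator k p n)) hcomp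
  exact AlgHom.coe_ringHom_injective h

/-- The inverse-free recursion `σʲ(uᵢ)·(1 + j·uᵢ) = uᵢ` (`j : ℕ`). [OURS · L1 W4.5c] -/
theorem coreSigmaHom_iterate_U (i : Fin n) (j : ℕ) :
    ((coreSigmaHom k p n : CoreRing k p n → CoreRing k p n)^[j]) (coreU k p n i) *
      (1 + (j : CoreRing k p n) * coreU k p n i) = coreU k p n i := by
  induction j with
  | zero => simp
  | succ j ih =>
    rw [Function.iterate_succ_apply']
    set a := ((coreSigmaHom k p n : CoreRing k p n → CoreRing k p n)^[j]) (coreU k p n i)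
    set u := coreU k p n i
    set τ := coreSigmaHom k p n
    have h1 : τ a * (1 + (j : CoreRing k p n) * τ u) = τ u := by
      have := congrArg τ ih
      rwa [map_mul, map_add, map_one, map_mul, map_natCast] at this
    have h2 : τ u * (1 + u) = u := coreSigmaHom_U k p n i
    push_cast
    linear_combination (1 + u) * h1 + (1 - (j : CoreRing k p n) * τ a) * h2

/-- `σ^p = id` pointwise. [OURS · L1 W4.5c] -/
theorem coreSigmaHom_iterate_p (x : CoreRing k p n) :
    ((coreSigmaHom k p n : CoreRing k p n → CoreRing k p n)^[p]) x = x := by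
  have hfun : ((coreSigmaHom k p n) ^ p).toRingHom = RingHom.id (CoreRing k p n) := by
    apply IsLocalization.ringHom_ext (Submonoid.powers (coreDenominator k p n))
    apply MvPolynomial.ringHom_ext
    · intro r
      simp only [RingHom.comp_apply, RingHomCompTriple.comp_eq]
      have h1 : algebraMap (MvPolynomial (Fin n) k) (CoreRing k p n) (C r) =
          algebraMap k (CoreRing k p n) r := by
        rw [← MvPolynomial.algebraMap_eq]
        exact (IsScalarTower.algebraMap_apply k (MvPolynomial (Fin n) k) (CoreRing k p n) r).symm
      rw [h1]
      exact ((coreSigmaHom k p n) ^ p).commutes r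
    · intro i
      simp only [RingHom.comp_apply, RingHomCompTriple.comp_eq]
      change ((coreSigmaHom k p n) ^ p) (coreU k p n i) = coreU k p n i
      have h := coreSigmaHom_iterate_U k p n i p
      rw [core_natCast_p, zero_mul, add_zero, mul_one] at h
      rw [AlgHom.coe_pow]; exact h
  have := congrArg (fun f : CoreRing k p n →+* CoreRing k p n => f x) hfun
  simp only [RingHom.id_apply] at this
  rw [← AlgHom.coe_pow]
  exact this

/-- `σ` is bijective (inverse `σ^{p−1}`). [OURS · L1 W4.5c] -/
theorem coreSigmaHom_bijective : Function.Bijective (coreSigmaHom k p n) := by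
  have hp : p - 1 + 1 = p := Nat.sub_add_cancel (Fact.out : p.Prime).one_le
  set τ : CoreRing k p n → CoreRing k p n := fun x => coreSigmaHom k p n x with hτ
  have hl : Function.LeftInverse (τ^[p - 1]) τ := fun x => by
    show τ^[p - 1] (τ x) = x
    rw [← Function.iterate_succ_apply τ (p - 1) x, Nat.succ_eq_add_one, hp]
    exact coreSigmaHom_iterate_p k p n x
  have hr : Function.RightInverse (τ^[p - 1]) τ := fun x => by
    show τ (τ^[p - 1] x) = x
    rw [← Function.iterate_succ_apply' τ (p - 1) x, Nat.succ_eq_add_one, hp]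
    exact coreSigmaHom_iterate_p k p n x
  exact ⟨hl.injective, hr.surjective⟩

/-- **The conductor-𝟙 automorphism `σ` of `Aₙ`.** [OURS · L1 W4.5c] -/
def coreSigma : CoreRing k p n ≃ₐ[k] CoreRing k p n :=
  AlgEquiv.ofBijective (coreSigmaHom k p n) (coreSigmaHom_bijective k p n)

/-- `coreSigma` is `coreSigmaHom` on elements. [OURS · L1 W4.5c] -/
theorem coreSigma_apply (x : CoreRing k p n) : coreSigma k p n x = coreSigmaHom k p n x := rfl

/-- The law for `coreSigma`. [OURS · L1 W4.5c] -/
theorem coreSigma_U (i : Fin n) :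
    coreSigma k p n (coreU k p n i) * (1 + coreU k p n i) = coreU k p n i := by
  rw [coreSigma_apply]; exact coreSigmaHom_U k p n i

/-- `coreSigma ^ p = 1`. [OURS · L1 W4.5c] -/
theorem coreSigma_pow_p : coreSigma k p n ^ p = 1 := by
  apply AlgEquiv.ext
  intro x
  rw [AlgEquiv.coe_pow]
  have : (⇑(coreSigma k p n))^[p] x =
      ((coreSigmaHom k p n : CoreRing k p n → CoreRing k p n)^[p]) x := by
    congr 1
  rw [this, coreSigmaHom_iterate_p]
  rfl

/-- **Existence** (idea-2's L11 `ConductorOneCoreAction`, body verbatim): an automorphism with the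
law and `σ^p = 1` exists. [OURS · L1 W4.5c] -/
theorem exists_alg_equiv_law :
    ∃ σ : CoreRing k p n ≃ₐ[k] CoreRing k p n,
      (∀ i : Fin n, σ (coreU k p n i) * (1 + coreU k p n i) = coreU k p n i) ∧ σ ^ p = 1 :=
  ⟨coreSigma k p n, coreSigma_U k p n, coreSigma_pow_p k p n⟩

end Construction

end Summit.ResolutionOfSingularities.ResolutionOfSingularities.Theorems.WildQuotientResolution.ConductorOne

end
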